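import Summits.HodgeConjecture.HodgeConjecture.Theorems.F0P2gStubNSIOfCore
import Literature.NumberTheory.Automorphic.UnitaryGroupOddLineNoIntegralEigenvector
import HarnessLib

/-!
# FLOOR-0 P2 — ROAD δ, file δ3 (part 2 of 2, the CLOSER): stub NSI `stub_NSI_nontrivialClassNotSpherical` of the rung-3 sub-line
# `Cruxes/H413/Lines/F0_P2PKRung3.lean` (crux item stmt-HodgeConjecture-24833 `HCCMUnconditional.H413`, binder `h413 ⇐ hdictE`)

Cell hodgecm-mathlib (D-0151), FLOOR 0, programme P2; ROAD δ (director s484; F0P2-p01 (g4) CUT 2026-08-31T05:50Z); seat B-p18 (g24).  ONE THEOREM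
(no `def`, no instance, no notation, no named fact, no `sorry`); never imports a `Cruxes/…/Lines` module: the body of
`F0P2PKRung3.StubNSINontrivialClassNotSpherical` (tree v1.1 :208–231) is RESTATED VERBATIM as the type of `stubNSI_holds`, and proved as
★ `F0P2gStubNSIOfCore.stubNSI_of_core` (NSI modulo (CORE′), part 1) applied to δ2's head ★
`UnitaryGroup.eq_zero_of_forall_implementer_eigen_of_odd` ((CORE′): at a good inert place a diagonal hermitian line of odd valuation class carries
no non-zero common eigenvector of the integral implementers — the integral uncertainty principle, `UnitaryGroupOddLineNoIntegralEigenvector`).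

WHAT IT SAYS ([GelbartRogawski1991, Lem. 5.1.2 p. 466, p. 467 L25–27]; [HarrisKudlaSweet1996, Thm. 6.1]): for a CM field `L`, at all but finitely many
finite places `v` of `L⁺`, for every `ε ∈ (L⁺)ˣ`, if Liu's local theta type `X_v(μ, ε, χ)` has a `U(diag dV)(𝒪_v)`-spherical line then `ε` is a local norm
at `v` — the class WITHOUT a self-dual lattice is never spherical.  `--supports stmt-HodgeConjecture-24833 --as helper`; A-plan ∕ F0P2-plan fold it into
`Lines/F0_P2PKRung3.lean` as `theorem stub_NSI_nontrivialClassNotSpherical : StubNSINontrivialClassNotSpherical := F0P2gStubNSINontrivialClassNotSpherical.stubNSI_holds`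
(PK rung 3 open set ↦ {PKΠ}).  HONEST LABEL: HC_CM is proved only modulo the printed citations until rung 0 closes; this file discharges none of them.

## References
* [GelbartRogawski1991] S. Gelbart, J. Rogawski, Invent. Math. 105 (1991): Lem. 5.1.2 p. 466, p. 467 L25–27.
* [HarrisKudlaSweet1996] M. Harris, S. Kudla, W. Sweet, J. AMS 9 (1996): Thm. 6.1.
* [Omeara1963] O. T. O'Meara, *Introduction to Quadratic Forms* (1963): §63C Example 63:16.
-/

set_option autoImplicit false
-- the mandated namespace has the single-problem summit's repeated segment (`HodgeConjecture.HodgeConjecture`)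
set_option linter.dupNamespace false

noncomputable section

open NumberField MeasureTheory IsDedekindDomain
open scoped Matrix ComplexOrder

namespace Summit.HodgeConjecture.HodgeConjecture.Cruxes.H413.F0P2gStubNSINontrivialClassNotSpherical

open Literature.NumberTheory Literature.NumberTheory.Automorphic Literature.NumberTheory.Automorphic.UnitaryGroup
open Literature.NumberTheory.Automorphic.IdeleClassGroup
open Literature.NumberTheory.Automorphic.Liu2021 Literature.NumberTheory.Automorphic.Liu2021.Def411WeilCarriers
open Literature.NumberTheory.GelbartRogawski1991 Literature.NumberTheory.GelbartRogawski1991.UnitaryDualPair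
open Literature.NumberTheory.GelbartRogawski1991.UnitaryDualPair.WeilCoinv
open Literature.RepresentationTheory Literature.RepresentationTheory.Liu2021
open Summit.HodgeConjecture.CorCM.Transposition

set_option synthInstance.maxHeartbeats 400000 in
set_option maxHeartbeats 2000000 in
/-- **stub NSI — the non-trivial class is not spherical, almost everywhere** (registered body of `F0P2PKRung3.StubNSINontrivialClassNotSpherical`
VERBATIM): ★ `stubNSI_of_core` (NSI ⟸ (CORE′)) at δ2's head ★ `UnitaryGroup.eq_zero_of_forall_implementer_eigen_of_odd` ((CORE′)).
[cite: GelbartRogawski1991, Lem 5.1.2 p. 466, p. 467] [cite: HarrisKudlaSweet1996, Thm 6.1] [cite: Omeara1963, §63C Example 63:16] -/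
theorem stubNSI_holds :
    ∀ (L : Type) [Field L] [NumberField L] [IsCMField L] {n' : ℕ} (e₁ : Fin 3 × Fin 1 ≃ Fin n') (dV : Fin 3 → L)
      (hdV : ∀ i, IsCMField.complexConj L (dV i) = dV i) (hdV0 : ∀ i, dV i ≠ 0)
      (μ : Literature.NumberTheory.Automorphic.IdeleClassGroup L →ₜ* Circle) (hμ : IsConjugateSymplectic L μ)
      (χ : Chi (↥(maximalRealSubfield L)) L (IsCMField.complexConj L)),
      ∀ᶠ v in Filter.cofinite, ∀ ε : (↥(maximalRealSubfield L))ˣ,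
        Representation.IsSpherical
                    (show Representation ℂ (localPi L (IsCMField.complexConj L) 3 (Matrix.diagonal dV) v) _ from
                      (TwistedCoinv.rep (localCharOfCenter (↥(maximalRealSubfield L)) L (IsCMField.complexConj L)
                          (JW (↥(maximalRealSubfield L)) L ε) (JW_apply_ne_zero (↥(maximalRealSubfield L)) L ε) χ.1 v)
                        ((OmegaChiSplitting.chiLocalSplittingsD ⟨L⟩ e₁ dV hdV hdV0 (toHeckeCharacter L μ)
                          ((isOscillatorChar_toHeckeCharacter_iff μ).mpr hμ) ε).omegaLoc v)
                        (commute_omegaLoc_localCenter (↥(maximalRealSubfield L)) L (IsCMField.complexConj L) 3 e₁ (Matrix.diagonal dV)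
                          (JW (↥(maximalRealSubfield L)) L ε) (complexConj_imagUnit L) (imagUnit_ne_zero L) (imagUnit_mul_self L)
                          (realDiagonal_isSymm L dV hdV) (isSymm_TW (↥(maximalRealSubfield L)) ε) (realDiagonal_map L dV hdV).symm
                          (JW_eq (↥(maximalRealSubfield L)) L ε) (JW_apply_ne_zero (↥(maximalRealSubfield L)) L ε)
                          (OmegaChiSplitting.chiLocalSplittingsD ⟨L⟩ e₁ dV hdV hdV0 (toHeckeCharacter L μ)
                            ((isOscillatorChar_toHeckeCharacter_iff μ).mpr hμ) ε) v)).comp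
                        (UnitaryGroup.localLineInl L (IsCMField.complexConj L) 3 e₁ (Matrix.diagonal dV) (JW (↥(maximalRealSubfield L)) L ε) v))
            (localInt L (IsCMField.complexConj L) 3 (Matrix.diagonal dV) v) →
          locF (↥(maximalRealSubfield L)) (imagUnitSq L) ε v = 1 :=
  F0P2gStubNSIOfCore.stubNSI_of_core @UnitaryGroup.eq_zero_of_forall_implementer_eigen_of_odd

end Summit.HodgeConjecture.HodgeConjecture.Cruxes.H413.F0P2gStubNSINontrivialClassNotSpherical

end
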